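import Literature.Analysis.OperatorTheory.PositiveKernelTransferOperator
import HarnessLib

/-!
# Venture YMGap, track Y3 FLOW-DATA — tools: JENSEN against a probability density and the LOG-RATIO LOWER BOUND for two
# positive kernels, `log ‖A'‖ − log ‖A‖ ≥ ‖A‖⁻¹ ∫ log(K'/K)·Ω(a)K(a,b)Ω(b)` (Kingman's inequality behind the convexity of `log λ₀`)

HONEST FRAMING: venture file of the cell `pub-ymgap` (QuantumFields programme), track Y3 (FLOW-DATA); abstract measure-theoretic
TOOLS (any measure space / finite measure space, bounded strongly measurable kernels, the kernel operators of
`Literature.Analysis.OperatorTheory.PositiveKernelTransferOperator`).  Used by `RectTubeCouplingSecant.lean` (the derivative-free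
Hellmann–Feynman sandwich of the tube's `log ‖T_J‖` between the plaquette expectations at the chord's ends).  No physics, no number.

* `integral_mul_le_log_integral_exp_mul` — for a probability density `p ≥ 0` (`∫ p = 1`) and bounded `f`: `∫ f p ≤ log ∫ e^{f} p`
  (elementary: `log t ≤ t − 1`);
* **`log_norm_sub_log_norm_ge_integral_log_ratio`** — `K > 0`, `0 < R₀ ≤ K'/K ≤ R₁`, kernel operators `A, A'`, `Ω ≥ 0` a unit top
  eigenvector of `A` (`‖A‖ > 0`): `‖A‖⁻¹ ∫ log(K'/K)·ΩKΩ d(μ⊗μ) ≤ log ‖A'‖ − log ‖A‖` (variational principle `‖A'‖ ≥ ⟪Ω, A'Ω⟫` + Jensen for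
  the probability density `ΩKΩ/‖A‖` on pairs).

References: J. F. C. Kingman, Quart. J. Math. 12 (1961) 283 [cite: Kingman1961]; M. Reed, B. Simon IV (1978) §XIII.12
[cite: ReedSimonIV1978, §XIII.12].
-/

noncomputable section

open scoped BigOperators ENNReal RealInnerProductSpace
open MeasureTheory Filter Function
open Literature.Analysis.OperatorTheory

namespace Summit.Ventures.YMGap.FlowData

/-! ### Jensen against a probability density (elementary form) -/

section Jensen

variable {Y : Type*} [MeasurableSpace Y] {ν : Measure Y}

/-- **Jensen for `log`, elementary**: for a probability density `p ≥ 0` (`∫ p dν = 1`) and a bounded strongly measurable `f`,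
`∫ f p dν ≤ log ∫ e^{f} p dν` (from `log t ≤ t − 1`). [folklore] -/
theorem integral_mul_le_log_integral_exp_mul {p f : Y → ℝ} (hp0 : ∀ᵐ y ∂ν, 0 ≤ p y) (hpi : Integrable p ν)
    (hp1 : ∫ y, p y ∂ν = 1) (hf : AEStronglyMeasurable f ν) {Cf : ℝ} (hCf : ∀ y, ‖f y‖ ≤ Cf) :
    ∫ y, f y * p y ∂ν ≤ Real.log (∫ y, Real.exp (f y) * p y ∂ν) := by
  have hfi : Integrable (fun y => f y * p y) ν := hpi.bdd_mul hf (Eventually.of_forall hCf)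
  have hef : AEStronglyMeasurable (fun y => Real.exp (f y)) ν := Real.continuous_exp.comp_aestronglyMeasurable hf
  have heb : ∀ y, ‖Real.exp (f y)‖ ≤ Real.exp Cf := fun y => by
    rw [Real.norm_eq_abs, abs_of_pos (Real.exp_pos _)]
    exact Real.exp_le_exp.2 ((le_abs_self _).trans ((Real.norm_eq_abs _).symm.le.trans (hCf y)))
  have hei : Integrable (fun y => Real.exp (f y) * p y) ν := hpi.bdd_mul hef (Eventually.of_forall heb)
  set m : ℝ := ∫ y, Real.exp (f y) * p y ∂ν with hm
  have hmpos : 0 < m := by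
    have hle : ∫ y, Real.exp (-Cf) * p y ∂ν ≤ m := by
      refine integral_mono_ae (hpi.const_mul _) hei ?_
      filter_upwards [hp0] with y hy
      refine mul_le_mul_of_nonneg_right (Real.exp_le_exp.2 ?_) hy
      have := hCf y; rw [Real.norm_eq_abs] at this; linarith [neg_abs_le (f y)]
    rw [integral_const_mul, hp1, mul_one] at hle
    exact lt_of_lt_of_le (Real.exp_pos _) hle
  have hkey : ∫ y, (f y - Real.log m) * p y ∂ν ≤ ∫ y, (Real.exp (f y) / m - 1) * p y ∂ν := by
    refine integral_mono_ae ?_ ?_ ?_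
    · exact (hfi.sub (hpi.const_mul _)).congr (Eventually.of_forall fun y => by simp only [Pi.sub_apply]; ring)
    · exact ((hei.div_const m).sub hpi).congr (Eventually.of_forall fun y => by simp only [Pi.sub_apply]; ring)
    · filter_upwards [hp0] with y hy
      refine mul_le_mul_of_nonneg_right ?_ hy
      have h := Real.log_le_sub_one_of_pos (div_pos (Real.exp_pos (f y)) hmpos)
      rw [Real.log_div (Real.exp_pos _).ne' hmpos.ne', Real.log_exp] at h
      exact h
  have hL : ∫ y, (f y - Real.log m) * p y ∂ν = ∫ y, f y * p y ∂ν - Real.log m := by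
    have : (fun y => (f y - Real.log m) * p y) = fun y => f y * p y - Real.log m * p y := by funext y; ring
    rw [this, integral_sub hfi (hpi.const_mul _), integral_const_mul, hp1, mul_one]
  have hR : ∫ y, (Real.exp (f y) / m - 1) * p y ∂ν = 0 := by
    have : (fun y => (Real.exp (f y) / m - 1) * p y) = fun y => m⁻¹ * (Real.exp (f y) * p y) - p y := by
      funext y; rw [div_eq_mul_inv]; ring
    rw [this, integral_sub (hei.const_mul _) hpi, integral_const_mul, ← hm, inv_mul_cancel₀ hmpos.ne', hp1, sub_self]
  rw [hL, hR] at hkey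
  linarith

end Jensen

/-! ### Abstract: the log-ratio lower bound for two positive kernels -/

section Ratio

variable {X : Type*} [MeasurableSpace X] {μ : Measure X} [IsFiniteMeasure μ]
  {K K' : X → X → ℝ} {C C' : ℝ} {A A' : Lp ℝ 2 μ →L[ℝ] Lp ℝ 2 μ}

/-- **`log ‖A'‖ − log ‖A‖ ≥ (1/‖A‖) ∫ log(K'/K) · Ω(a)K(a,b)Ω(b)`** for bounded strongly measurable kernels `K > 0`, `K'` with
`0 < R₀ ≤ K'/K ≤ R₁`, kernel operators `A, A'`, and a nonnegative unit top eigenvector `Ω` of `A` (`AΩ = ‖A‖Ω`, `‖A‖ > 0`):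
the variational principle `‖A'‖ ≥ ⟪Ω, A'Ω⟫` and Jensen for the probability density `ΩKΩ/‖A‖` on pairs. [cite: Kingman1961] -/
theorem log_norm_sub_log_norm_ge_integral_log_ratio (hK : StronglyMeasurable (uncurry K)) (hC : ∀ x y, ‖K x y‖ ≤ C)
    (hK' : StronglyMeasurable (uncurry K')) (hC' : ∀ x y, ‖K' x y‖ ≤ C') (hKpos : ∀ x y, 0 < K x y)
    {R₀ R₁ : ℝ} (hR₀ : 0 < R₀) (hR : ∀ x y, R₀ ≤ K' x y / K x y ∧ K' x y / K x y ≤ R₁)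
    (hA : ∀ φ : Lp ℝ 2 μ, (A φ : X → ℝ) =ᵐ[μ] fun x => ∫ y, K x y * φ y ∂μ)
    (hA' : ∀ φ : Lp ℝ 2 μ, (A' φ : X → ℝ) =ᵐ[μ] fun x => ∫ y, K' x y * φ y ∂μ) (hA0 : 0 < ‖A‖)
    {Ω : Lp ℝ 2 μ} (h1 : ‖Ω‖ = 1) (hΩ : ∀ᵐ x ∂μ, 0 ≤ Ω x) (heig : A Ω = ‖A‖ • Ω) :
    ‖A‖⁻¹ * ∫ z, Real.log (K' z.1 z.2 / K z.1 z.2) * (Ω z.1 * K z.1 z.2 * Ω z.2) ∂(μ.prod μ) ≤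
      Real.log ‖A'‖ - Real.log ‖A‖ := by
  set lam : ℝ := ‖A‖ with hlam
  -- the pair integrands
  have hIK : Integrable (fun z : X × X => Ω z.1 * (K z.1 z.2 * Ω z.2)) (μ.prod μ) := integrable_mul_kernel_mul hK hC Ω Ω
  have hIK' : Integrable (fun z : X × X => Ω z.1 * (K' z.1 z.2 * Ω z.2)) (μ.prod μ) := integrable_mul_kernel_mul hK' hC' Ω Ω
  -- `⟪Ω, AΩ⟫ = λ` and `= ∫ ΩKΩ`
  have hinnerA : ⟪Ω, A Ω⟫ = lam := by
    rw [heig, inner_smul_right, real_inner_self_eq_norm_sq, h1, one_pow, mul_one]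
  have hprodA : ∫ z, Ω z.1 * (K z.1 z.2 * Ω z.2) ∂(μ.prod μ) = lam := by
    rw [← hinnerA, inner_kernelOp_eq_integral hA, integral_prod _ hIK]
    refine integral_congr_ae (Eventually.of_forall fun x => ?_)
    exact integral_const_mul (Ω x) _
  have hprodA' : ∫ z, Ω z.1 * (K' z.1 z.2 * Ω z.2) ∂(μ.prod μ) = ⟪Ω, A' Ω⟫ := by
    rw [inner_kernelOp_eq_integral hA', integral_prod _ hIK']
    refine integral_congr_ae (Eventually.of_forall fun x => ?_)
    exact integral_const_mul (Ω x) _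
  -- the probability density `F = ΩKΩ/λ` on pairs
  set F : X × X → ℝ := fun z => lam⁻¹ * (Ω z.1 * (K z.1 z.2 * Ω z.2)) with hF
  have hFi : Integrable F (μ.prod μ) := hIK.const_mul _
  have hF1 : ∫ z, F z ∂(μ.prod μ) = 1 := by
    rw [hF, integral_const_mul, hprodA, inv_mul_cancel₀ hA0.ne']
  have hΩ1 : ∀ᵐ z ∂(μ.prod μ), 0 ≤ Ω z.1 := (Measure.quasiMeasurePreserving_fst (μ := μ) (ν := μ)).ae hΩ
  have hΩ2 : ∀ᵐ z ∂(μ.prod μ), 0 ≤ Ω z.2 := (Measure.quasiMeasurePreserving_snd (μ := μ) (ν := μ)).ae hΩ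
  have hF0 : ∀ᵐ z ∂(μ.prod μ), 0 ≤ F z := by
    filter_upwards [hΩ1, hΩ2] with z h1z h2z
    exact mul_nonneg (inv_nonneg.2 hA0.le) (mul_nonneg h1z (mul_nonneg (hKpos _ _).le h2z))
  -- the log-ratio is bounded and measurable
  set f : X × X → ℝ := fun z => Real.log (K' z.1 z.2 / K z.1 z.2) with hf
  have hfm : AEStronglyMeasurable f (μ.prod μ) := by
    have hm : Measurable fun z : X × X => K' z.1 z.2 / K z.1 z.2 :=
      (hK'.measurable.comp measurable_id).div (hK.measurable.comp measurable_id)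
    exact (Real.measurable_log.comp hm).aestronglyMeasurable
  have hfb : ∀ z, ‖f z‖ ≤ max |Real.log R₀| |Real.log R₁| := by
    intro z
    obtain ⟨hlo, hhi⟩ := hR z.1 z.2
    have hRpos : 0 < K' z.1 z.2 / K z.1 z.2 := lt_of_lt_of_le hR₀ hlo
    rw [Real.norm_eq_abs, abs_le]
    constructor
    · have := Real.log_le_log hR₀ hlo
      linarith [neg_abs_le (Real.log R₀), le_max_left |Real.log R₀| |Real.log R₁|]
    · have := Real.log_le_log hRpos hhi
      linarith [le_abs_self (Real.log R₁), le_max_right |Real.log R₀| |Real.log R₁|]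
  -- Jensen: `∫ f F ≤ log ∫ e^f F = log (⟪Ω, A'Ω⟫/λ)`
  have hJ := integral_mul_le_log_integral_exp_mul hF0 hFi hF1 hfm hfb
  have hexp : ∫ z, Real.exp (f z) * F z ∂(μ.prod μ) = lam⁻¹ * ⟪Ω, A' Ω⟫ := by
    rw [← hprodA', ← integral_const_mul]
    refine integral_congr_ae (Eventually.of_forall fun z => ?_)
    rw [hf, hF]
    dsimp only
    rw [Real.exp_log (lt_of_lt_of_le hR₀ (hR z.1 z.2).1)]
    have hk : K z.1 z.2 ≠ 0 := (hKpos _ _).ne'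
    field_simp
  have hpos' : 0 < lam⁻¹ * ⟪Ω, A' Ω⟫ := by
    rw [← hexp]
    have hle : ∫ z, R₀ * F z ∂(μ.prod μ) ≤ ∫ z, Real.exp (f z) * F z ∂(μ.prod μ) := by
      refine integral_mono_ae (hFi.const_mul _) ?_ ?_
      · exact hFi.bdd_mul (Real.continuous_exp.comp_aestronglyMeasurable hfm) (Eventually.of_forall fun z => by
          rw [Real.norm_eq_abs, abs_of_pos (Real.exp_pos _)]
          exact Real.exp_le_exp.2 ((le_abs_self _).trans ((Real.norm_eq_abs _).symm.le.trans (hfb z))))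
      · filter_upwards [hF0] with z hz
        refine mul_le_mul_of_nonneg_right ?_ hz
        rw [hf]
        dsimp only
        rw [Real.exp_log (lt_of_lt_of_le hR₀ (hR z.1 z.2).1)]
        exact (hR z.1 z.2).1
    rw [integral_const_mul, hF1, mul_one] at hle
    exact lt_of_lt_of_le hR₀ hle
  have hRay : ⟪Ω, A' Ω⟫ ≤ ‖A'‖ := by
    calc ⟪Ω, A' Ω⟫ ≤ ‖Ω‖ * ‖A' Ω‖ := real_inner_le_norm _ _
      _ ≤ ‖Ω‖ * (‖A'‖ * ‖Ω‖) := mul_le_mul_of_nonneg_left (A'.le_opNorm Ω) (norm_nonneg _)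
      _ = ‖A'‖ := by rw [h1]; ring
  have hlogle : Real.log (lam⁻¹ * ⟪Ω, A' Ω⟫) ≤ Real.log ‖A'‖ - Real.log lam := by
    have hi : 0 < ⟪Ω, A' Ω⟫ := by
      have := hpos'; rwa [mul_pos_iff_of_pos_left (inv_pos.2 hA0)] at this
    rw [Real.log_mul (inv_pos.2 hA0).ne' hi.ne', Real.log_inv]
    linarith [Real.log_le_log hi hRay]
  -- assemble
  have hlhs : ‖A‖⁻¹ * ∫ z, Real.log (K' z.1 z.2 / K z.1 z.2) * (Ω z.1 * K z.1 z.2 * Ω z.2) ∂(μ.prod μ) =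
      ∫ z, f z * F z ∂(μ.prod μ) := by
    rw [← integral_const_mul]
    refine integral_congr_ae (Eventually.of_forall fun z => ?_)
    rw [hf, hF]
    dsimp only
    ring
  rw [hlhs]
  rw [hexp] at hJ
  exact hJ.trans hlogle

end Ratio

end Summit.Ventures.YMGap.FlowData
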